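import Summits.ValiantsHypothesis.ValiantsHypothesis.Theorems.LacunarySymmetroidMatrixDescartesCensusBox20
import Summits.ValiantsHypothesis.ValiantsHypothesis.Theorems.LacunarySymmetroidMatrixDescartesCensusTNCUnifFam01381
import Summits.ValiantsHypothesis.ValiantsHypothesis.Theorems.LacunarySymmetroidMatrixDescartesCensusBox000103081222

/-!
# `MatrixDescartes` census — door A on the COMPLETE RAY `(ζ(2,6; 0, 1, 3, 8, 12, N) ≤ 19` for EVERY `N : ℕ`)

HONEST FRAMING.  Object-search cell `pub-symmetroid`, door-A item `Theses.LacunarySymmetroid.DoorA26 = PosRootLawAt 2 6 19`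
(stmt-ValiantsHypothesis-19979; OPEN, typed, never asserted).  Assembly, from theorems in the tree, of a ONE-PARAMETER FAMILY OF SUPPORTS
WITH NO THRESHOLD on which the door-A row holds: for every natural number `N`, every real symmetric `2 × 2` pencil on `(0, 1, 3, 8, 12,N)` has at
most `19 = D(2,6) − 1` distinct positive det-roots (`doorA26_on_ray_0_1_3_8_12`).  Regimes: `N ≤ 20` is the kernel BOX20 theorem
(`Census.doorA26_box20`); in the gap `21 ≤ N ≤ 24` the supports with a repeated pair sum (`3+21 = 12+12` (N = 21), `1+23 = 12+12` (N = 23), `0+24 = 12+12` (N = 24)) have at most `20` monomials, hence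
at most `19` positive roots (`Census.posRoots_two_le_of_card_pairSums`), and the 2-Sidon ones (N = 22) are the kernel replays of
engine-3's shell certificates (`box21-26.jsonl`): `Census.doorA26_on_0_1_3_8_12_22`; `N ≥ 25` is the typer's UNIFORM T-NC certificate
`Census.posRoots_le_19_on_2_6_0_1_3_8_12_N`.  Along this ray the «all-supports residue outside the box» is EMPTY.  Nothing here about other rays, the `V = 19`
layer, `DoorA26` on all supports, the crux `MatrixDescartes` (stmt-ValiantsHypothesis-18050) or `VP ≠ VNP`.

[folklore] Assembly of kernel theorems of the tree; elementary.
-/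

-- `Summit.ValiantsHypothesis.ValiantsHypothesis.…` repeats a component by the D-0017 layout
-- (single-conjunct summit), which the `dupNamespace` linter flags; the name is mandated.
set_option linter.dupNamespace false

namespace Summit.ValiantsHypothesis.ValiantsHypothesis.Theorems.LacunarySymmetroidMatrixDescartes.Census

open Polynomial Finset
open scoped BigOperators Polynomial Matrix
open Summit.ValiantsHypothesis.ValiantsHypothesis.Theorems.MatrixDescartes.Negative (PosRootLawAt)

/-- The non-Sidon members of the gap: for `21 ≤ N ≤ 24`, `N ∉ {22}`, the support `(0, 1, 3, 8, 12,N)` has at most `20` distinct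
pair sums (`3+21 = 12+12` (N = 21), `1+23 = 12+12` (N = 23), `0+24 = 12+12` (N = 24)). [folklore] -/
theorem card_pairSums_0_1_3_8_12_le (N : ℕ) (h21 : 21 ≤ N) (hhi : N ≤ 24) (h22 : N ≠ 22) :
    ((Finset.univ : Finset (Fin 6 × Fin 6)).image
      (fun p => (![0, 1, 3, 8, 12, N] : Fin 6 → ℕ) p.1 + (![0, 1, 3, 8, 12, N] : Fin 6 → ℕ) p.2)).card ≤ 20 := by
  interval_cases N <;> first | exact absurd rfl h22 | decide

/-- `N ≤ 20`: the literal vector `(0, 1, 3, 8, 12,N)` lies in a window of width `20`, so the kernel BOX20 theorem applies. [folklore] -/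
theorem doorA26_on_0_1_3_8_12_of_le_20 (N : ℕ) (hN : N ≤ 20) : PosRootLawOn 2 6 19 (![0, 1, 3, 8, 12, N] : Fin 6 → ℕ) := by
  apply doorA26_box20
  intro i j
  fin_cases i <;> fin_cases j <;> simp <;> omega

/-- **Door A on a COMPLETE RAY (no threshold): `ζ(2,6; 0, 1, 3, 8, 12, N) ≤ 19` for EVERY natural number `N`.** [folklore] -/
theorem doorA26_on_ray_0_1_3_8_12 (N : ℕ) : PosRootLawOn 2 6 19 (![0, 1, 3, 8, 12, N] : Fin 6 → ℕ) := by
  by_cases h20 : N ≤ 20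
  · exact doorA26_on_0_1_3_8_12_of_le_20 N h20
  by_cases h22 : N = 22
  · subst h22; exact doorA26_on_0_1_3_8_12_22
  by_cases hhi : N ≤ 24
  · intro S _hS
    exact posRoots_two_le_of_card_pairSums (K := 6) (B := 19) (by norm_num) _
      (by have h := card_pairSums_0_1_3_8_12_le N (by omega) hhi h22; omega) S
  · intro S hS
    exact posRoots_le_19_on_2_6_0_1_3_8_12_N N (by omega) S hS

/-- The same ray in counted form. [folklore] -/
theorem doorA26_on_ray_0_1_3_8_12_card (N : ℕ) (S : Fin 6 → Matrix (Fin 2) (Fin 2) ℝ) (hS : ∀ l, (S l).IsSymm) :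
    ((∑ l, ((X : ℝ[X]) ^ (![0, 1, 3, 8, 12, N] : Fin 6 → ℕ) l) • (S l).map C).det.roots.toFinset.filter
      (fun t => 0 < t)).card ≤ 19 :=
  doorA26_on_ray_0_1_3_8_12 N S hS

end Summit.ValiantsHypothesis.ValiantsHypothesis.Theorems.LacunarySymmetroidMatrixDescartes.Census
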